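import Literature.Geometry.Lorentzian.Stationary
import Literature.Geometry.Lorentzian.CompleteStationaryVacuumFlatProofs
import Literature.Topology.FourManifolds.MorseExtrema
import Literature.Geometry.Lorentzian.KillingFieldCurvatureIdentities
import Literature.Geometry.Lorentzian.HessianLocalMax
import Literature.Geometry.Lorentzian.NullRigidityOfDominatedPair
import Literature.Geometry.Lorentzian.CausalityOpennessProofs

/-!
# `ErgoregionBombModT` — evanescent light points of a vacuum hole are algebraically special
# (crux stmt-FinalStateConjecture-17838, line `killing-light-points`, lead c4)

Route `ZeroEnergyKerrOrBomb` of the Final State Conjecture, crux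
`Summit.FinalStateConjecture.FinalStateConjecture.Theses.ZeroEnergyKerrOrBomb.ErgoregionBombModT`
(the ergoregion bomb modulo the stationary flow), line `killing-light-points`, skeleton v4: the
crux is, losslessly, `OffWallBomb ∧ LightPointBomb` (p139708); `LightPointBomb` demands an
exponentially growing Killing mode of every telescope hole carrying a Killing light point
(`p ∈ ⟨⟨M_ext⟩⟩`, `g(T,T)(p) = 0`, `∇_T T = κT`), and its EVANESCENT species — `T` causal on the
whole d.o.c. and null at one of its points, i.e. a local maximum of `g(T,T)` with value `0` — is
the sub-claim on which the crux demands a bomb of a hole WITHOUT ergoregion (p141962).  This file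
shows that species to be ALGEBRAICALLY SPECIAL, pointwise, in any Ricci-flat space-time:

**Theorem** (`wedge_and_repeatedPND_of_isLocalMax_of_null`).  Let `T` be a Killing field,
`p` a local maximum of `λ = g(T,T)` with `T(p)` null and non-zero, and `Ric(T,T)(p) = 0`.  Then
1. `∇T(p) = T♭ ∧ β♭` is a NULL BIVECTOR: `∇_v T = g(T,v) β - g(β,v) T` for some `β ⊥ T(p)`;
2. `R(v, T)T = μ g(T,v) T` for all `v`, with `μ ≥ 0`: in vacuum (`R = Weyl`) the null direction
   `T(p)` is a REPEATED PRINCIPAL NULL DIRECTION of the Weyl tensor (`Ψ₀ = Ψ₁ = 0` along `T`);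
3. (`dalembertian_val_killing_eq_zero_of_isLocalMax_of_null`) `□ g(T,T)(p) = 0`, the indefinite
   invariant `tr(∇T ∘ ∇T)` ("`B² - E²`" of the Killing 2-form) vanishing at `p`.

Proof.  At a local maximum the covariant Hessian is negative semidefinite
(`PseudoRiemannianMetric.hessian_apply_self_nonpos_of_isLocalMax`) and, for `λ = g(T,T)` of a
Killing field, `Hess λ (v,v) = 2 g(∇_v T, ∇_v T) - 2 g(R(v,T)T, v)` (O'Neill 1983, Ch. 9, Ex. 9
(b), `IsKillingField.hessian_val_self_apply`); Fermat gives `∇_T T = 0`; `Ric(T,T)` is the trace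
of `v ↦ R(v,T)T`.  The rest is linear algebra at a null vector of a Lorentzian scalar product
(`null_rigidity_of_dominated`, over an orthonormal screen frame, `NullScreenAlgebra.lean`): the
skew map `A = ∇T(p)` kills `ℓ = T(p)`, so `A v ⊥ ℓ` and `g(A v, A v) ≥ 0`; domination makes
`E(v,w) = g(R(v,T)T, w)` positive semidefinite with vanishing screen trace, hence zero on
`ℓ^⊥ = screen ⊕ ℝℓ`, hence `E = μ ℓ♭ ⊗ ℓ♭`; and on `ℓ^⊥` the dominated form `g(A v, A v)` vanishes,
so `A(ℓ^⊥) ⊆ ℝℓ`, which pairs with a transverse vector to `A = ℓ ∧ β`.  These are the constraints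
of a vacuum non-expanding null structure (cf. isolated horizons, `Ψ₀ = Ψ₁ = 0`), obtained from the
maximum principle instead of the Raychaudhuri equation.  The hypotheses actually used (Killing,
local maximum of `g(T,T)` with value `0`, `Ric(T,T)(p) = 0`) are realised at every point of the
degenerate horizon of extreme Reissner–Nordström (generator causal on both sides, `β, μ ≠ 0`), so
no contradiction follows from them alone: emptiness of the species is a global matter.

Consequence for the crux (registered certificates `evanescentLightPoint_wedge_and_repeatedPND`,
`evanescentLightPoint_dalembertian_eq_zero`; certificates, not obligations of the skeleton): the
evanescent species of `LightPointBomb` — the only species on which the bomb is heuristically absurd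
— lives inside the locus where the stationary vacuum geometry is algebraically special ALONG `T`
(`λ = 0`, `dλ = 0`, `Ψ₀ = Ψ₁ = 0` for the null direction `T`, `∇T ∧ ∇T = 0`, `⟨∇T, ∇T⟩ = 0`): far
more conditions than the three dimensions of the orbit space can generically meet, and void in any
region of Petrov type I.  This is the quantitative content of the leads' recommendation to move the
light-point residue to the rigidity side (restate 17838 := `OffWallBomb`, file `NoDocLightPoints`
with `NonTrappingHawkingRigidity`): what the crux asks of evanescent light points is a statement
about a uniqueness-type phantom, not about a mechanism.

Contents (the linear algebra `null_rigidity_of_dominated`, `trace_comp_self_eq_zero_of_eq_wedge` is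
`Literature/Geometry/Lorentzian/NullRigidityOfDominatedPair.lean`): `wedge_and_repeatedPND_of_isLocalMax_of_null`, `dalembertian_val_killing_eq_zero_of_isLocalMax_of_null`
(any `StationaryAFBlackHole` presentation, pointwise hypotheses); `isLocalMax_val_killing_of_causal_of_null`
and the two closed-form certificates (d.o.c. version: `T` causal on `⟨⟨M_ext⟩⟩`, the d.o.c. being
open).

References: B. O'Neill, *Semi-Riemannian geometry* (1983), Ch. 5, Lemma 5.26–5.28; Ch. 9,
Prop. 9.25, Exercises 8–9; S. W. Hawking, G. F. R. Ellis (1973), §4.2 (pseudo-orthonormal frames);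
A. Ashtekar, C. Beetle, J. Lewandowski, *Geometry of generic isolated horizons*, Class. Quantum
Grav. 19 (2002) 1195, §2 (`Ψ₀ = Ψ₁ = 0` on non-expanding horizons); crux workfiles
`Cruxes/ErgoregionBombModT/Lines/killing_light_points.lean` (skeleton v4), `…/Disproof.lean` §1, §7;
`Theorems/ZeroEnergyKerrOrBombErgoregionBombModTEvanescent.lean` (p141962, the species).
-/

noncomputable section

open Bundle Set Filter Function Module
open scoped Manifold Topology

-- summit = problem name (D-0017)
set_option linter.dupNamespace false

namespace Summit.FinalStateConjecture.FinalStateConjecture.Theorems.ErgoregionBombModT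

open Literature.Geometry.Lorentzian


/-! ### Evanescent light points of a stationary space-time -/

section Manifold

variable {𝓑 : StationaryAFBlackHole.{0}} [𝓑.metric.HasLeviCivita]

/-- A local maximum of `g(T,T)` is a hovering light point, `∇_T T = 0` (Fermat on the
boundaryless carrier, `IsLocalMax.isMCriticalPt`, and the Killing identity
`2 g(Y, ∇_T T) = -Y g(T,T)`, `IsKillingField.two_mul_val_leviCivita_self_apply_self`).  Local copy
of `leviCivita_killing_self_eq_zero_of_isLocalMax` (p141962) kept private to spare an import.
O'Neill 1983, Ch. 9, Prop. 9.25. [cite: ONeill1983, Ch. 9, Prop. 9.25] -/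
private theorem leviCivita_killing_self_eq_zero_of_isLocalMax' {p : 𝓑.carrier}
    (hmax : IsLocalMax (fun y ↦ 𝓑.metric.val y (𝓑.killing y) (𝓑.killing y)) p) :
    𝓑.metric.leviCivita 𝓑.killing p (𝓑.killing p) = 0 := by
  have hK := 𝓑.isStationaryKilling.isKillingField
  have hd : mfderiv (𝓡 4) 𝓘(ℝ, ℝ) (fun y ↦ 𝓑.metric.val y (𝓑.killing y) (𝓑.killing y)) p = 0 :=
    Literature.Topology.FourManifolds.IsLocalMax.isMCriticalPt (I := 𝓡 4) hmax
  refine 𝓑.metric.nondegenerate p _ fun Y₀ ↦ ?_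
  have h := hK.two_mul_val_leviCivita_self_apply_self p Y₀
  have h0 : mvfderiv (𝓡 4) (fun y ↦ 𝓑.metric.val y (𝓑.killing y) (𝓑.killing y)) p Y₀ = 0 := by
    change mfderiv (𝓡 4) 𝓘(ℝ, ℝ) (fun y ↦ 𝓑.metric.val y (𝓑.killing y) (𝓑.killing y)) p Y₀ = 0
    rw [hd]; rfl
  rw [h0, neg_zero] at h
  rw [𝓑.metric.symm p]
  linarith

/-- **Evanescent light points are algebraically special.**  Let `T` be the stationary Killing
field of `𝓑` and `p` a local maximum of `g(T,T)` at which `T` is null and non-zero (an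
*evanescent* light point: `T` is causal near `p`), and suppose `Ric(T,T)(p) = 0`.  Then
(i) `∇T(p)` is the null bivector `T♭ ∧ β♭`: `∇_v T = g(T,v) β - g(β,v) T` for some `β ⊥ T(p)`;
(ii) `R(v, T)T = μ g(T, v) T` for some `μ ≥ 0` and all `v` — in vacuum (`R = Weyl`) this says that
`T(p)` is a repeated principal null direction of the Weyl tensor, `Ψ₀ = Ψ₁ = 0` along `T`.
Proof: the covariant Hessian of `g(T,T)` at the local maximum is negative semidefinite
(`PseudoRiemannianMetric.hessian_apply_self_nonpos_of_isLocalMax`) and equals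
`2 g(∇_v T, ∇_v T) - 2 g(R(v,T)T, v)` (O'Neill 1983, Ch. 9, Ex. 9 (b),
`IsKillingField.hessian_val_self_apply`); `∇_T T = 0` at the maximum; `Ric(T,T)` is the trace of
`v ↦ R(v,T)T`; the rest is `null_rigidity_of_dominated` over an orthonormal screen frame of
`T(p)` (`exists_orthonormal_screen`).  The conclusions are those of a vacuum non-expanding null
structure (cf. Ashtekar–Beetle–Lewandowski, isolated horizons: `Ψ₀ = Ψ₁ = 0`), obtained here from
the maximum principle instead of the Raychaudhuri equation. [cite: ONeill1983, Ch. 9, Ex. 9 (b)] -/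
theorem wedge_and_repeatedPND_of_isLocalMax_of_null {p : 𝓑.carrier}
    (hRic : 𝓑.metric.ricci p (𝓑.killing p) (𝓑.killing p) = 0)
    (hmax : IsLocalMax (fun y ↦ 𝓑.metric.val y (𝓑.killing y) (𝓑.killing y)) p)
    (hnull : 𝓑.metric.val p (𝓑.killing p) (𝓑.killing p) = 0) (hT0 : 𝓑.killing p ≠ 0) :
    (∃ β : TangentSpace (𝓡 4) p, 𝓑.metric.val p β (𝓑.killing p) = 0 ∧
        ∀ v, 𝓑.metric.leviCivita 𝓑.killing p v =
          𝓑.metric.val p (𝓑.killing p) v • β - 𝓑.metric.val p β v • 𝓑.killing p) ∧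
      ∃ μ : ℝ, 0 ≤ μ ∧ ∀ v, 𝓑.metric.riemann p v (𝓑.killing p) (𝓑.killing p) =
        (μ * 𝓑.metric.val p (𝓑.killing p) v) • 𝓑.killing p := by
  set g := 𝓑.metric.toPseudoRiemannianMetric with hg
  have hK : g.IsKillingField 𝓑.killing := 𝓑.isStationaryKilling.isKillingField
  have hLC : g.IsLeviCivita g.leviCivita := PseudoRiemannianMetric.isLeviCivita_leviCivita_holds
  have hX2 : ContMDiff (𝓡 4) ((𝓡 4).prod 𝓘(ℝ, E4)) 2
      (fun x ↦ (TotalSpace.mk' E4 x (𝓑.killing x) : TangentBundle (𝓡 4) 𝓑.carrier)) :=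
    hK.contMDiff_two ENat.LEInfty.out
  have hf : ContMDiffAt (𝓡 4) 𝓘(ℝ, ℝ) 2 (fun y ↦ g.val y (𝓑.killing y) (𝓑.killing y)) p :=
    g.contMDiffAt_val_apply ENat.LEInfty.out (hX2 p) (hX2 p)
  -- the two endomorphisms
  set A : TangentSpace (𝓡 4) p →L[ℝ] TangentSpace (𝓡 4) p := g.leviCivita 𝓑.killing p with hAdef
  set F : TangentSpace (𝓡 4) p →ₗ[ℝ] TangentSpace (𝓡 4) p :=
    g.leviCivita.ricciAux p (𝓑.killing p) (𝓑.killing p) with hFdef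
  have hFapp : ∀ v, F v = g.riemann p v (𝓑.killing p) (𝓑.killing p) := fun v ↦ rfl
  -- hypotheses of the algebra
  have hA : ∀ v w, g.val p ((A : TangentSpace (𝓡 4) p →ₗ[ℝ] TangentSpace (𝓡 4) p) v) w +
      g.val p v ((A : TangentSpace (𝓡 4) p →ₗ[ℝ] TangentSpace (𝓡 4) p) w) = 0 :=
    fun v w ↦ hK.2 p v w
  have hAℓ : (A : TangentSpace (𝓡 4) p →ₗ[ℝ] TangentSpace (𝓡 4) p) (𝓑.killing p) = 0 :=
    leviCivita_killing_self_eq_zero_of_isLocalMax' hmax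
  have hFℓ : F (𝓑.killing p) = 0 := by
    have h := g.leviCivita.curvature_antisymm (x := p) (𝓑.killing p) (𝓑.killing p) (𝓑.killing p)
    have h2 : (2 : ℝ) • g.leviCivita.curvature p (𝓑.killing p) (𝓑.killing p) (𝓑.killing p) = 0 := by
      rw [two_smul]; nth_rw 1 [h]; exact neg_add_cancel _
    exact (smul_eq_zero.1 h2).resolve_left (by norm_num)
  have hFskew : ∀ u, g.val p (F u) (𝓑.killing p) = 0 := fun u ↦ by
    have h := hLC.val_curvature_skew ENat.LEInfty.out p u (𝓑.killing p) (𝓑.killing p) (𝓑.killing p)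
    change g.val p (g.leviCivita.curvature p u (𝓑.killing p) (𝓑.killing p)) (𝓑.killing p) = 0
    linarith
  have hFsymm : ∀ u w, g.val p (F u) w = g.val p (F w) u := fun u w ↦ by
    change g.val p (g.leviCivita.curvature p u (𝓑.killing p) (𝓑.killing p)) w =
      g.val p (g.leviCivita.curvature p w (𝓑.killing p) (𝓑.killing p)) u
    have e1 := hLC.val_curvature_pair_symm ENat.LEInfty.out p u (𝓑.killing p) (𝓑.killing p) w
    have e2 := PseudoRiemannianMetric.val_curvature_antisymm (g := g) (cov := g.leviCivita) p
      (𝓑.killing p) w u (𝓑.killing p)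
    have e3 := hLC.val_curvature_skew ENat.LEInfty.out p w (𝓑.killing p) u (𝓑.killing p)
    linarith
  have htr : LinearMap.trace ℝ _ F = 0 := hRic
  have hH : ∀ v, g.val p ((A : TangentSpace (𝓡 4) p →ₗ[ℝ] TangentSpace (𝓡 4) p) v)
      ((A : TangentSpace (𝓡 4) p →ₗ[ℝ] TangentSpace (𝓡 4) p) v) ≤ g.val p (F v) v := by
    intro v
    have h1 := g.hessian_apply_self_nonpos_of_isLocalMax hf hmax v
    rw [hK.hessian_val_self_apply ENat.LEInfty.out v v] at h1
    change g.val p (A v) (A v) ≤ g.val p (g.riemann p v (𝓑.killing p) (𝓑.killing p)) v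
    change 2 * g.val p (A v) (A v) - 2 * g.val p (g.riemann p v (𝓑.killing p) (𝓑.killing p)) v ≤ 0
      at h1
    linarith
  -- an orthonormal screen frame of the null vector `T(p)`
  obtain ⟨Tm, hTm⟩ := 𝓑.metric.exists_timelike p
  obtain ⟨e, hon, heℓ, -⟩ := exists_orthonormal_screen (V := E4) (g.val p)
    (fun v w ↦ g.symm p v w) (fun t w ↦ 𝓑.metric.pos_of_orthogonal p t w) hTm hnull hT0
  have h4 : finrank ℝ E4 = 4 := finrank_euclideanSpace_fin
  have hcard : Fintype.card (Fin (finrank ℝ E4 - 2)) + 2 = finrank ℝ E4 := by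
    rw [Fintype.card_fin, h4]
  obtain ⟨-, ⟨μ, hμ, hFμ⟩, β, hβℓ, hAβ⟩ := null_rigidity_of_dominated (V := E4) (g.val p)
    (fun v w ↦ g.symm p v w) (fun t w ↦ 𝓑.metric.pos_of_orthogonal p t w) hTm hon hnull hT0 heℓ
    hcard (A : TangentSpace (𝓡 4) p →ₗ[ℝ] TangentSpace (𝓡 4) p) hA hAℓ F hFℓ hFskew hFsymm htr hH
  exact ⟨⟨β, hβℓ, fun v ↦ hAβ v⟩, μ, hμ, fun v ↦ (hFapp v).symm.trans (hFμ v)⟩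

/-- **`□ g(T,T) = 0` at an evanescent light point** (same hypotheses): O'Neill 1983, Ch. 9,
Ex. 9 (c), `□ g(T,T) = -2 tr(∇T ∘ ∇T) - 2 Ric(T,T)` (`IsKillingField.dalembertian_val_self`),
where `∇T ∘ ∇T` is the traceless rank-one map `v ↦ -g(β,β) g(T,v) T`
(`trace_comp_self_eq_zero_of_eq_wedge`) and `Ric(T,T)(p) = 0`.  So at the points where the
causal Killing field `T` touches the light cone from inside, the indefinite "`B² - E²`" invariant
`tr(∇T ∘ ∇T)` of the Killing 2-form vanishes together with `□ g(T,T)`.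
[cite: ONeill1983, Ch. 9, Ex. 9 (c)] -/
theorem dalembertian_val_killing_eq_zero_of_isLocalMax_of_null {p : 𝓑.carrier}
    (hRic : 𝓑.metric.ricci p (𝓑.killing p) (𝓑.killing p) = 0)
    (hmax : IsLocalMax (fun y ↦ 𝓑.metric.val y (𝓑.killing y) (𝓑.killing y)) p)
    (hnull : 𝓑.metric.val p (𝓑.killing p) (𝓑.killing p) = 0) (hT0 : 𝓑.killing p ≠ 0) :
    𝓑.metric.dalembertian (fun y ↦ 𝓑.metric.val y (𝓑.killing y) (𝓑.killing y)) p = 0 := by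
  set g := 𝓑.metric.toPseudoRiemannianMetric with hg
  have hK : g.IsKillingField 𝓑.killing := 𝓑.isStationaryKilling.isKillingField
  obtain ⟨⟨β, hβℓ, hAβ⟩, -⟩ := wedge_and_repeatedPND_of_isLocalMax_of_null hRic hmax hnull hT0
  have htr := (trace_comp_self_eq_zero_of_eq_wedge (V := E4) (g.val p) hnull hβℓ
    (fun v w ↦ g.symm p v w)
    (g.leviCivita 𝓑.killing p : TangentSpace (𝓡 4) p →ₗ[ℝ] TangentSpace (𝓡 4) p)
    (fun v ↦ hAβ v)).2
  have htr' : LinearMap.trace ℝ (TangentSpace (𝓡 4) p)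
      ((g.leviCivita 𝓑.killing p : TangentSpace (𝓡 4) p →ₗ[ℝ] TangentSpace (𝓡 4) p) ∘ₗ
        (g.leviCivita 𝓑.killing p : TangentSpace (𝓡 4) p →ₗ[ℝ] TangentSpace (𝓡 4) p)) = 0 := htr
  have hRic' : g.ricci p (𝓑.killing p) (𝓑.killing p) = 0 := hRic
  have h := hK.dalembertian_val_self ENat.LEInfty.out p
  rw [htr', hRic', mul_zero, mul_zero, sub_zero] at h
  exact h

end Manifold

/-! ### Closed forms (registered certificates of crux stmt-FinalStateConjecture-17838) -/

section Certificates

variable {𝓑 : StationaryAFBlackHole.{0}} [𝓑.metric.HasLeviCivita]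

omit [𝓑.metric.HasLeviCivita] in
/-- On a hole whose stationary field is causal on the whole d.o.c., a null point of `T` in the
(open) d.o.c. is a local maximum of `g(T,T)` (`StationaryAFBlackHole.isOpen_doc` with the
discharged openness facts of `I±`). [folklore] -/
theorem isLocalMax_val_killing_of_causal_of_null
    (hcausal : ∀ x ∈ 𝓑.doc, 𝓑.metric.val x (𝓑.killing x) (𝓑.killing x) ≤ 0)
    {p : 𝓑.carrier} (hp : p ∈ 𝓑.doc) (hnull : 𝓑.metric.val p (𝓑.killing p) (𝓑.killing p) = 0) :
    IsLocalMax (fun y ↦ 𝓑.metric.val y (𝓑.killing y) (𝓑.killing y)) p := by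
  have hopen : IsOpen 𝓑.doc :=
    𝓑.isOpen_doc LorentzianMetric.isOpen_chronologicalFuture_holds_of_boundaryless
      LorentzianMetric.isOpen_chronologicalPast_holds_of_boundaryless
  filter_upwards [hopen.mem_nhds hp] with y hy
  rw [hnull]
  exact hcausal y hy

end Certificates

/-- **Evanescent light points of a vacuum hole are algebraically special** (registered
certificate `evanescentLightPoint_wedge_and_repeatedPND` of crux stmt-FinalStateConjecture-17838 —
a certificate, not an obligation of the skeleton).  For a Ricci-flat presentation whose stationary
field `T` is CAUSAL on the whole domain of outer communications (`g(T,T) ≤ 0` on `⟨⟨M_ext⟩⟩`: no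
ergoregion) and null and non-zero at a point `p ∈ ⟨⟨M_ext⟩⟩` — the EVANESCENT species of
`LightPointBomb`, on which the crux demands a bomb of a hole without ergoregion (p141962) — the
geometry at `p` is algebraically special along `T`: `∇T(p) = T♭ ∧ β♭` is a null bivector and
`R(·, T)T = μ g(T, ·) T` with `μ ≥ 0`, i.e. `T(p)` is a repeated principal null direction of the
Weyl tensor (`Ψ₀ = Ψ₁ = 0`).  So this species is empty wherever the stationary vacuum geometry is
algebraically general along `T`. [cite: ONeill1983, Ch. 9, Ex. 9 (b)] -/
theorem evanescentLightPoint_wedge_and_repeatedPND :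
    ∀ (𝓑 : Literature.Geometry.Lorentzian.StationaryAFBlackHole.{0}) [𝓑.metric.HasLeviCivita], 𝓑.metric.toPseudoRiemannianMetric.IsRicciFlat → (∀ x ∈ 𝓑.doc, 𝓑.metric.val x (𝓑.killing x) (𝓑.killing x) ≤ 0) → ∀ p ∈ 𝓑.doc, 𝓑.metric.val p (𝓑.killing p) (𝓑.killing p) = 0 → 𝓑.killing p ≠ 0 → (∃ β : TangentSpace (𝓡 4) p, 𝓑.metric.val p β (𝓑.killing p) = 0 ∧ ∀ v : TangentSpace (𝓡 4) p, 𝓑.metric.leviCivita 𝓑.killing p v = 𝓑.metric.val p (𝓑.killing p) v • β - 𝓑.metric.val p β v • 𝓑.killing p) ∧ ∃ μ : ℝ, 0 ≤ μ ∧ ∀ v : TangentSpace (𝓡 4) p, 𝓑.metric.riemann p v (𝓑.killing p) (𝓑.killing p) = (μ * 𝓑.metric.val p (𝓑.killing p) v) • 𝓑.killing p := by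
  intro 𝓑 _ hRic hcausal p hp hnull hT0
  have hR : 𝓑.metric.ricci p (𝓑.killing p) (𝓑.killing p) = 0 := by
    rw [show 𝓑.metric.ricci p = 0 from hRic p]; rfl
  exact wedge_and_repeatedPND_of_isLocalMax_of_null hR
    (isLocalMax_val_killing_of_causal_of_null hcausal hp hnull) hnull hT0

/-- **`□ g(T,T) = 0` at an evanescent light point of a vacuum hole** (registered certificate
`evanescentLightPoint_dalembertian_eq_zero` of crux stmt-FinalStateConjecture-17838 — a
certificate, not an obligation of the skeleton): same hypotheses; O'Neill 1983, Ch. 9, Ex. 9 (c)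
with `tr(∇T ∘ ∇T) = 0` (`∇T` a null bivector) and `Ric = 0`. [cite: ONeill1983, Ch. 9, Ex. 9 (c)] -/
theorem evanescentLightPoint_dalembertian_eq_zero :
    ∀ (𝓑 : Literature.Geometry.Lorentzian.StationaryAFBlackHole.{0}) [𝓑.metric.HasLeviCivita], 𝓑.metric.toPseudoRiemannianMetric.IsRicciFlat → (∀ x ∈ 𝓑.doc, 𝓑.metric.val x (𝓑.killing x) (𝓑.killing x) ≤ 0) → ∀ p ∈ 𝓑.doc, 𝓑.metric.val p (𝓑.killing p) (𝓑.killing p) = 0 → 𝓑.killing p ≠ 0 → 𝓑.metric.dalembertian (fun y ↦ 𝓑.metric.val y (𝓑.killing y) (𝓑.killing y)) p = 0 := by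
  intro 𝓑 _ hRic hcausal p hp hnull hT0
  have hR : 𝓑.metric.ricci p (𝓑.killing p) (𝓑.killing p) = 0 := by
    rw [show 𝓑.metric.ricci p = 0 from hRic p]; rfl
  exact dalembertian_val_killing_eq_zero_of_isLocalMax_of_null hR
    (isLocalMax_val_killing_of_causal_of_null hcausal hp hnull) hnull hT0

end Summit.FinalStateConjecture.FinalStateConjecture.Theorems.ErgoregionBombModT

end
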